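import Literature.NumberTheory.Sieve.ParityWave0OddLogChowlaDefs
import Mathlib.NumberTheory.Primorial
import Mathlib.NumberTheory.SumPrimeReciprocals
import Mathlib.Analysis.SpecialFunctions.Log.Basic
import HarnessLib

/-!
# Odd-order logarithmic Chowla (Tao–Teräväinen 2018): prime sums and harmonic sums for §3

Topic `Literature/NumberTheory/Sieve`; support file towards the named fact
`Literature.NumberTheory.Sieve.liouville_logCorrelation_isLittleO_of_odd` (**parity.S22**,
`ParityWave0.lean`): T. Tao, J. Teräväinen, *Odd order cases of the logarithmically averaged
Chowla conjecture*, J. Théor. Nombres Bordeaux 30 (2018), 997–1015 (arXiv:1710.02112), §3 (the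
deduction of Theorem 1.1 from Theorems 3.1 and 3.2: "Averaging over all such `m` and using the
prime number theorem …", "one can easily compute that
`𝔼^{log}_{H₃ < n ≤ H₄ : (n,W)=1} 1_{p₁ | n} = (1 + O(ε²))/p₁`"). Everything here is PROVED; no
definitions, no named facts. The elementary inputs about primes and harmonic sums that this
averaging needs, in the weak forms that suffice (no prime number theorem):

* `OddLogChowla.mul_card_dyadicPrimes_le`, `OddLogChowla.sum_dyadicPrimes_one_div_le` —
  Chebyshev's upper bound in a dyadic block, `∑_{2^m < p ≤ 2^{m+1}} 1/p ≤ 4/m`, from Mathlib's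
  `primorial_le_four_pow`;
* `OddLogChowla.sum_Ico_sum_dyadicPrimes_eq`, `OddLogChowla.exists_sum_dyadicPrimes_one_div_ge` —
  Euler's divergence of `∑_p 1/p` along dyadic blocks, from Mathlib's
  `not_summable_one_div_on_primes`;
* `OddLogChowla.abs_sum_residue_harmonic_sub_le` — harmonic sums in a residue class:
  `|∑_{(N-b)/W < d ≤ (N'-b)/W} 1/(Wd+b) - (1/W) log(N'/N)| ≤ 4/N` for `4W ≤ N ≤ N'`, `b ≤ W`
  (term-wise comparison with `1/(Wd)`, `1/(W(d+1))` and `1/d ≤ log d - log(d-1)`,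
  `log(d+1) - log d ≤ 1/d`).

## References
* T. Tao, J. Teräväinen, J. Théor. Nombres Bordeaux 30 (2018), §3. [TaoTeravainenJTNB2018]
-/

noncomputable section

open Finset Filter

namespace Literature.NumberTheory.Sieve

namespace OddLogChowla

/-! ### Primes in dyadic blocks: Chebyshev's upper bound and Euler's divergence -/

/-- **Chebyshev's upper bound for a dyadic block**: `m · #{2^m < p ≤ 2^{m+1}} ≤ 2^{m+2}`
(from `∏_{p ≤ n} p ≤ 4^n`). [folklore] -/
theorem mul_card_dyadicPrimes_le (m : ℕ) : m * (dyadicPrimes m).card ≤ 2 ^ (m + 2) := by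
  have h1 : (2 ^ m) ^ (dyadicPrimes m).card ≤ ∏ p ∈ dyadicPrimes m, p := by
    apply Finset.pow_card_le_prod
    intro p hp
    exact ((mem_dyadicPrimes.mp hp).1.1).le
  have h2 : ∏ p ∈ dyadicPrimes m, p ≤ primorial (2 ^ (m + 1)) := by
    unfold primorial
    apply Finset.prod_le_prod_of_subset_of_one_le'
    · intro p hp
      rw [mem_dyadicPrimes] at hp
      rw [Finset.mem_filter, Finset.mem_range]
      exact ⟨Nat.lt_succ_of_le hp.1.2, hp.2⟩
    · intro p hp _
      exact ((Finset.mem_filter.mp hp).2).one_lt.le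
  have h3 : primorial (2 ^ (m + 1)) ≤ 4 ^ (2 ^ (m + 1)) := primorial_le_four_pow _
  have h4 : (2 ^ m) ^ (dyadicPrimes m).card ≤ 2 ^ (2 ^ (m + 2)) := by
    refine h1.trans (h2.trans (h3.trans (le_of_eq ?_)))
    rw [show (4 : ℕ) = 2 ^ 2 by norm_num, ← pow_mul, pow_succ 2 (m + 1)]
    ring_nf
  rw [← pow_mul] at h4
  exact (Nat.pow_le_pow_iff_right (by norm_num : 1 < 2)).mp h4

/-- `∑_{2^m < p ≤ 2^{m+1}} 1/p ≤ 4/m` (`m ≥ 1`). [folklore] -/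
theorem sum_dyadicPrimes_one_div_le {m : ℕ} (hm : 1 ≤ m) :
    ∑ p ∈ dyadicPrimes m, (1 : ℝ) / p ≤ 4 / m := by
  have hm0 : (0 : ℝ) < m := by exact_mod_cast hm
  have h2m : (0 : ℝ) < 2 ^ m := by positivity
  have hterm : ∀ p ∈ dyadicPrimes m, (1 : ℝ) / p ≤ 1 / 2 ^ m := fun p hp =>
    one_div_le_one_div_of_le h2m (by exact_mod_cast ((mem_dyadicPrimes.mp hp).1.1).le)
  refine (Finset.sum_le_sum hterm).trans ?_
  rw [Finset.sum_const, nsmul_eq_mul]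
  have h := mul_card_dyadicPrimes_le m
  have h' : (m : ℝ) * (dyadicPrimes m).card ≤ 2 ^ (m + 2) := by exact_mod_cast h
  rw [mul_one_div, div_le_div_iff₀ h2m hm0]
  calc ((dyadicPrimes m).card : ℝ) * m = m * (dyadicPrimes m).card := by ring
    _ ≤ 2 ^ (m + 2) := h'
    _ = 4 * 2 ^ m := by ring

/-- **Blocks partition a range of primes**: `∑_{m₁ ≤ m < m₂} ∑_{p ∈ (2^m, 2^{m+1}]} F(p) =
∑_{2^{m₁} < p ≤ 2^{m₂}} F(p)`. [folklore] -/
theorem sum_Ico_sum_dyadicPrimes_eq (F : ℕ → ℝ) {m₁ m₂ : ℕ} (h : m₁ ≤ m₂) :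
    ∑ m ∈ Finset.Ico m₁ m₂, ∑ p ∈ dyadicPrimes m, F p =
      ∑ p ∈ (Ioc (2 ^ m₁) (2 ^ m₂)).filter Nat.Prime, F p := by
  induction m₂, h using Nat.le_induction with
  | base => simp
  | succ m₂ hm ih =>
    rw [Finset.sum_Ico_succ_top hm, ih]
    have hsplit : (Ioc (2 ^ m₁) (2 ^ (m₂ + 1))).filter Nat.Prime =
        (Ioc (2 ^ m₁) (2 ^ m₂)).filter Nat.Prime ∪ dyadicPrimes m₂ := by
      rw [dyadicPrimes, ← Finset.filter_union, Finset.Ioc_union_Ioc_eq_Ioc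
        (Nat.pow_le_pow_right (by norm_num) hm) (Nat.pow_le_pow_right (by norm_num) (by omega))]
    rw [hsplit, Finset.sum_union]
    refine Finset.disjoint_left.mpr fun n hn hn' => ?_
    simp only [dyadicPrimes, Finset.mem_filter, Finset.mem_Ioc] at hn hn'
    omega

/-- **Euler: `∑_p 1/p` diverges, along dyadic blocks**: for every `K` and `m₁` there is `m₂ > m₁`
with `∑_{m₁ ≤ m < m₂} ∑_{2^m < p ≤ 2^{m+1}} 1/p ≥ K` (from Mathlib's
`not_summable_one_div_on_primes`). [folklore] -/
theorem exists_sum_dyadicPrimes_one_div_ge (K : ℝ) (m₁ : ℕ) :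
    ∃ m₂ : ℕ, m₁ < m₂ ∧ K ≤ ∑ m ∈ Finset.Ico m₁ m₂, ∑ p ∈ dyadicPrimes m, (1 : ℝ) / p := by
  classical
  set g : ℕ → ℝ := Set.indicator {p | p.Prime} (fun n : ℕ => (1 : ℝ) / n) with hg
  have hg0 : ∀ n, 0 ≤ g n := fun n => Set.indicator_nonneg (fun p _ => by positivity) n
  have hdiv : Tendsto (fun N => ∑ n ∈ Finset.range N, g n) atTop atTop :=
    (not_summable_iff_tendsto_nat_atTop_of_nonneg hg0).mp not_summable_one_div_on_primes
  -- partial sums over `(2^{m₁}, 2^{m₂}]`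
  have hpart : ∀ A B : ℕ, A ≤ B → ∑ n ∈ (Ioc A B).filter Nat.Prime, (1 : ℝ) / n =
      ∑ n ∈ Finset.range (B + 1), g n - ∑ n ∈ Finset.range (A + 1), g n := by
    intro A B hAB
    rw [Finset.sum_filter, Finset.range_eq_Ico, Finset.range_eq_Ico,
      ← Finset.sum_Ico_consecutive _ (Nat.zero_le (A + 1)) (by omega : A + 1 ≤ B + 1),
      add_sub_cancel_left, Finset.Ico_add_one_add_one_eq_Ioc]
    refine Finset.sum_congr rfl fun n _ => ?_
    simp only [hg, Set.indicator_apply, Set.mem_setOf_eq]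
  obtain ⟨N, hN⟩ := (tendsto_atTop_atTop.mp hdiv) (K + ∑ n ∈ Finset.range (2 ^ m₁ + 1), g n)
  -- choose `m₂ > m₁` with `2^{m₂} + 1 ≥ N`
  refine ⟨max (m₁ + 1) N, by omega, ?_⟩
  set m₂ := max (m₁ + 1) N with hm₂
  rw [sum_Ico_sum_dyadicPrimes_eq _ (by omega : m₁ ≤ m₂), hpart _ _ (Nat.pow_le_pow_right (by norm_num) (by omega))]
  have hmono : ∑ n ∈ Finset.range N, g n ≤ ∑ n ∈ Finset.range (2 ^ m₂ + 1), g n := by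
    apply Finset.sum_le_sum_of_subset_of_nonneg
    · apply Finset.range_subset_range.mpr
      have : N ≤ m₂ := le_max_right _ _
      have : m₂ < 2 ^ m₂ := Nat.lt_two_pow_self
      omega
    · intro n _ _; exact hg0 n
  linarith [hN N le_rfl]

/-! ### Harmonic sums over integers coprime to `W` -/

/-- Telescoping over `(A, B]`: `∑_{A < d ≤ B} (f(d) - f(d-1)) = f(B) - f(A)`. [folklore] -/
theorem sum_Ioc_sub_pred_telescope (f : ℕ → ℝ) {A B : ℕ} (h : A ≤ B) :
    ∑ d ∈ Ioc A B, (f d - f (d - 1)) = f B - f A := by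
  induction B, h using Nat.le_induction with
  | base => simp
  | succ B hB ih =>
    rw [Finset.sum_Ioc_succ_top (by omega), ih, Nat.add_sub_cancel]
    ring

/-- `1/d ≤ log d - log (d-1)` for `d ≥ 2`. [folklore] -/
theorem one_div_le_log_sub_log {d : ℕ} (hd : 2 ≤ d) :
    (1 : ℝ) / d ≤ Real.log d - Real.log (d - 1 : ℕ) := by
  have hd0 : (0 : ℝ) < d := by exact_mod_cast (show 0 < d by omega)
  have hd1 : (0 : ℝ) < ((d - 1 : ℕ) : ℝ) := by exact_mod_cast (show 0 < d - 1 by omega)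
  have h := Real.log_le_sub_one_of_pos (div_pos hd1 hd0)
  rw [Real.log_div hd1.ne' hd0.ne'] at h
  have hcast : (((d - 1 : ℕ) : ℝ)) = (d : ℝ) - 1 := by
    rw [Nat.cast_sub (by omega)]; simp
  rw [hcast] at h ⊢
  have : ((d : ℝ) - 1) / d - 1 = -(1 / d) := by field_simp; ring
  linarith

/-- `log (d+1) - log d ≤ 1/d` for `d ≥ 1`. [folklore] -/
theorem log_succ_sub_log_le {d : ℕ} (hd : 1 ≤ d) :
    Real.log (d + 1 : ℕ) - Real.log d ≤ (1 : ℝ) / d := by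
  have hd0 : (0 : ℝ) < d := by exact_mod_cast hd
  have h := Real.log_le_sub_one_of_pos (show (0 : ℝ) < (d + 1 : ℕ) / d by positivity)
  rw [Real.log_div (by positivity) hd0.ne'] at h
  have : ((d + 1 : ℕ) : ℝ) / d - 1 = 1 / d := by push_cast; field_simp; ring
  linarith

/-- **Harmonic sums in a residue class.** For `W ≥ 1`, `0 ≤ b ≤ W`, `4W ≤ N ≤ N'`:
`|∑_{(N-b)/W < d ≤ (N'-b)/W} 1/(Wd+b) - (1/W) log(N'/N)| ≤ 4/N`. [folklore] -/
theorem abs_sum_residue_harmonic_sub_le {W b N N' : ℕ} (hW : 1 ≤ W) (hbW : b ≤ W)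
    (hN : 4 * W ≤ N) (hNN' : N ≤ N') :
    |∑ d ∈ Ioc ((N - b) / W) ((N' - b) / W), (1 : ℝ) / ((W * d + b : ℕ) : ℝ) -
      (1 / (W : ℝ)) * Real.log ((N' : ℝ) / N)| ≤ 4 / N := by
  set A := (N - b) / W with hA
  set Bd := (N' - b) / W with hBd
  have hW0 : (0 : ℝ) < W := by exact_mod_cast hW
  have hN0 : (0 : ℝ) < N := by exact_mod_cast (show 0 < N by omega)
  have hN'0 : (0 : ℝ) < N' := by exact_mod_cast (show 0 < N' by omega)
  have hAB : A ≤ Bd := Nat.div_le_div_right (by omega)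
  -- `A ≥ 3` and the real bounds `A > (N-2W)/W`, `Bd ≤ N'/W`
  have hA3 : 3 ≤ A := by
    rw [hA, Nat.le_div_iff_mul_le (by omega)]; omega
  have hAreal : ((N : ℝ) - 2 * W) / W ≤ A := by
    -- `W * A > N - b - W ≥ N - 2W`
    have h1 : N - b < W * A + W := by
      have := Nat.lt_div_mul_add (a := N - b) (show 0 < W by omega)
      rw [hA]; linarith [this, Nat.mul_comm ((N - b) / W) W]
    rw [div_le_iff₀ hW0]
    have h2 : ((N - b : ℕ) : ℝ) = N - b := by rw [Nat.cast_sub (by omega)]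
    have h3 : ((N - b : ℕ) : ℝ) < W * A + W := by exact_mod_cast h1
    have hb : (b : ℝ) ≤ W := by exact_mod_cast hbW
    rw [h2] at h3
    linarith
  have hBreal : (Bd : ℝ) ≤ (N' : ℝ) / W := by
    rw [le_div_iff₀ hW0]
    have h1 : W * Bd ≤ N' - b := by rw [hBd]; exact Nat.mul_div_le _ _
    have h2 : ((W * Bd : ℕ) : ℝ) ≤ ((N' - b : ℕ) : ℝ) := by exact_mod_cast h1
    rw [Nat.cast_sub (by omega)] at h2
    push_cast at h2
    have hb : (0 : ℝ) ≤ b := Nat.cast_nonneg _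
    linarith
  have hB2real : (N' : ℝ) / W ≤ (Bd : ℝ) + 2 := by
    -- `W * Bd + W > N' - b ≥ N' - W`
    have h1 : N' - b < W * Bd + W := by
      have := Nat.lt_div_mul_add (a := N' - b) (show 0 < W by omega)
      rw [hBd]; linarith [this, Nat.mul_comm ((N' - b) / W) W]
    rw [div_le_iff₀ hW0]
    have h2 : ((N' - b : ℕ) : ℝ) = N' - b := by rw [Nat.cast_sub (by omega)]
    have h3 : ((N' - b : ℕ) : ℝ) < W * Bd + W := by exact_mod_cast h1
    have hb : (b : ℝ) ≤ W := by exact_mod_cast hbW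
    rw [h2] at h3
    nlinarith
  have hA2real : (A : ℝ) + 2 ≤ ((N : ℝ) + 2 * W) / W := by
    rw [le_div_iff₀ hW0]
    have h1 : W * A ≤ N - b := by rw [hA]; exact Nat.mul_div_le _ _
    have h2 : ((W * A : ℕ) : ℝ) ≤ ((N - b : ℕ) : ℝ) := by exact_mod_cast h1
    rw [Nat.cast_sub (by omega)] at h2
    push_cast at h2
    have hb : (0 : ℝ) ≤ b := Nat.cast_nonneg _
    linarith
  -- termwise bounds `1/(W(d+1)) ≤ 1/(Wd+b) ≤ 1/(Wd)`
  have hup : ∀ d ∈ Ioc A Bd, (1 : ℝ) / ((W * d + b : ℕ) : ℝ) ≤ (1 / (W : ℝ)) * (1 / d) := by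
    intro d hd
    have hd1 : 1 ≤ d := by have := (Finset.mem_Ioc.mp hd).1; omega
    have hd0 : (0 : ℝ) < d := by exact_mod_cast hd1
    have hpos : (0 : ℝ) < ((W * d + b : ℕ) : ℝ) := by
      exact_mod_cast Nat.add_pos_left (Nat.mul_pos (by omega) hd1) b
    rw [one_div_mul_one_div, one_div_le_one_div hpos (by positivity)]
    push_cast; nlinarith [Nat.cast_nonneg (α := ℝ) b]
  have hlo : ∀ d ∈ Ioc A Bd, (1 / (W : ℝ)) * (1 / ((d + 1 : ℕ) : ℝ)) ≤ 1 / ((W * d + b : ℕ) : ℝ) := by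
    intro d hd
    have hd1 : 1 ≤ d := by have := (Finset.mem_Ioc.mp hd).1; omega
    have hpos : (0 : ℝ) < ((W * d + b : ℕ) : ℝ) := by
      exact_mod_cast Nat.add_pos_left (Nat.mul_pos (by omega) hd1) b
    rw [one_div_mul_one_div, one_div_le_one_div (by positivity) hpos]
    push_cast
    have hb : (b : ℝ) ≤ W := by exact_mod_cast hbW
    nlinarith
  -- upper bound: `∑ ≤ (1/W) log(Bd/A) ≤ (1/W)(log(N'/N) + 4W/N)`
  have hsum_up : ∑ d ∈ Ioc A Bd, (1 : ℝ) / ((W * d + b : ℕ) : ℝ) ≤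
      (1 / (W : ℝ)) * (Real.log Bd - Real.log A) := by
    refine (Finset.sum_le_sum hup).trans ?_
    rw [← Finset.mul_sum]
    refine mul_le_mul_of_nonneg_left ?_ (by positivity)
    have h1 : ∀ d ∈ Ioc A Bd, (1 : ℝ) / d ≤ Real.log d - Real.log (d - 1 : ℕ) := fun d hd =>
      one_div_le_log_sub_log (by have := (Finset.mem_Ioc.mp hd).1; omega)
    refine (Finset.sum_le_sum h1).trans (le_of_eq ?_)
    exact sum_Ioc_sub_pred_telescope (fun d => Real.log d) hAB
  have hsum_lo : (1 / (W : ℝ)) * (Real.log (Bd + 2 : ℕ) - Real.log (A + 2 : ℕ)) ≤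
      ∑ d ∈ Ioc A Bd, (1 : ℝ) / ((W * d + b : ℕ) : ℝ) := by
    refine le_trans ?_ (Finset.sum_le_sum hlo)
    rw [← Finset.mul_sum]
    refine mul_le_mul_of_nonneg_left ?_ (by positivity)
    have h1 : ∀ d ∈ Ioc A Bd, Real.log (d + 2 : ℕ) - Real.log (d + 1 : ℕ) ≤ 1 / ((d + 1 : ℕ) : ℝ) :=
      fun d _ => by
        have := log_succ_sub_log_le (d := d + 1) (by omega)
        push_cast at this ⊢
        ring_nf at this ⊢
        exact this
    refine le_trans (le_of_eq ?_) (Finset.sum_le_sum h1)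
    have := sum_Ioc_sub_pred_telescope (fun d => Real.log (d + 2 : ℕ)) hAB
    rw [← this]
    refine Finset.sum_congr rfl fun d hd => ?_
    have hd1 : 1 ≤ d := by have := (Finset.mem_Ioc.mp hd).1; omega
    congr 2
    push_cast
    rw [Nat.cast_sub hd1]; push_cast; ring
  -- the logarithms
  have hA0 : (0 : ℝ) < A := by exact_mod_cast (show 0 < A by omega)
  have hlogup : Real.log Bd - Real.log A ≤ Real.log ((N' : ℝ) / N) + 4 * W / N := by
    have hN2W : (0 : ℝ) < N - 2 * W := by
      have : (4 * W : ℝ) ≤ N := by exact_mod_cast hN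
      linarith
    have h1 : Real.log Bd ≤ Real.log ((N' : ℝ) / W) :=
      Real.log_le_log (by exact_mod_cast (show 0 < Bd by omega)) hBreal
    have h2 : Real.log (((N : ℝ) - 2 * W) / W) ≤ Real.log A := Real.log_le_log (by positivity) hAreal
    have h3 : Real.log ((N' : ℝ) / W) - Real.log (((N : ℝ) - 2 * W) / W) =
        Real.log ((N' : ℝ) / N) + Real.log ((N : ℝ) / (N - 2 * W)) := by
      rw [Real.log_div hN'0.ne' hW0.ne', Real.log_div hN2W.ne' hW0.ne',
        Real.log_div hN'0.ne' hN0.ne', Real.log_div hN0.ne' hN2W.ne']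
      ring
    -- `log (N/(N-2W)) ≤ 4W/N`
    have h4 : Real.log ((N : ℝ) / (N - 2 * W)) ≤ 4 * W / N := by
      have h5 := Real.log_le_sub_one_of_pos (show (0 : ℝ) < N / (N - 2 * W) by positivity)
      have h6 : (N : ℝ) / (N - 2 * W) - 1 = 2 * W / (N - 2 * W) := by field_simp; ring
      have h7 : (2 : ℝ) * W / (N - 2 * W) ≤ 4 * W / N := by
        rw [div_le_div_iff₀ hN2W hN0]
        have : (4 * W : ℝ) ≤ N := by exact_mod_cast hN
        nlinarith
      linarith
    linarith
  have hloglo : Real.log ((N' : ℝ) / N) - 2 * W / N ≤ Real.log (Bd + 2 : ℕ) - Real.log (A + 2 : ℕ) := by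
    have h1 : Real.log ((N' : ℝ) / W) ≤ Real.log (Bd + 2 : ℕ) :=
      Real.log_le_log (by positivity) (by push_cast; exact hB2real)
    have h2 : Real.log (A + 2 : ℕ) ≤ Real.log (((N : ℝ) + 2 * W) / W) :=
      Real.log_le_log (by positivity) (by push_cast; exact hA2real)
    have h3 : Real.log ((N' : ℝ) / W) - Real.log (((N : ℝ) + 2 * W) / W) =
        Real.log ((N' : ℝ) / N) - Real.log (((N : ℝ) + 2 * W) / N) := by
      rw [Real.log_div hN'0.ne' hW0.ne', Real.log_div (by positivity) hW0.ne',
        Real.log_div hN'0.ne' hN0.ne', Real.log_div (by positivity) hN0.ne']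
      ring
    have h4 : Real.log (((N : ℝ) + 2 * W) / N) ≤ 2 * W / N := by
      have h5 := Real.log_le_sub_one_of_pos (show (0 : ℝ) < (N + 2 * W) / N by positivity)
      have h6 : ((N : ℝ) + 2 * W) / N - 1 = 2 * W / N := by field_simp; ring
      linarith
    linarith
  -- conclude
  have h24 : (2 : ℝ) / N ≤ 4 / N := div_le_div_of_nonneg_right (by norm_num) hN0.le
  rw [abs_le]
  constructor
  · have := mul_le_mul_of_nonneg_left hloglo (show (0 : ℝ) ≤ 1 / W by positivity)
    have h8 : (1 / (W : ℝ)) * (2 * W / N) = 2 / N := by field_simp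
    have h9 : (1 / (W : ℝ)) * (Real.log ((N' : ℝ) / N) - 2 * W / N) =
        1 / W * Real.log ((N' : ℝ) / N) - 2 / N := by rw [mul_sub, h8]
    linarith [hsum_lo]
  · have := mul_le_mul_of_nonneg_left hlogup (show (0 : ℝ) ≤ 1 / W by positivity)
    have h8 : (1 / (W : ℝ)) * (4 * W / N) = 4 / N := by field_simp
    have h9 : (1 / (W : ℝ)) * (Real.log ((N' : ℝ) / N) + 4 * W / N) =
        1 / W * Real.log ((N' : ℝ) / N) + 4 / N := by rw [mul_add, h8]
    linarith [hsum_up]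

end OddLogChowla

end Literature.NumberTheory.Sieve
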